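import Summits.AtomisticToContinuum.Crystallization.Theorems.ChartedZeroExcessLayeredLatticeLiouvilleXX

/-!
# Zero-excess layered lattice Liouville — part XY (lens-2 g60, node «WildByBudget»): (Mᵇ) and (R_Wᵇ) from the line [Tᵇ] ∧ [W_Ψᵇ] ∧ [SBᵇ] —
# no Gehring lemma, no [KS], no Caccioppoli inequality, no (K)

The structural finding of part XX one level up.  [SBᵇ] `SubWindowBudgetBPG` budgets the bond energy of `p ↦ p − Ψ p` by `A_B·η` per site on EVERY
atom-centred ball of radius `≥ ρ₀` inside the window — at the smallest admissible scale `ρ := max ρ₀ 5` this is a POINTWISE bound on the identity-frame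
star strain of part XX: `σ_x² ≤ starSum ≤ bondEnergy (S ∩ B(x,ρ)) ≤ A_B·η·#(S ∩ B(x,ρ)) ≤ A_B·(2ρ/δ+1)³·η =: M·η` for every `x ∈ win R` (packing only,
part UA).  [SBᵇ]'s two window hypotheses (tameness on `win 9R`, `(ϑ₁, ω₁)`-coherence by `Ψ`) are exactly the conclusions of [Tᵇ] `TameWindowBPG` and
[W_Ψᵇ] `CoherentWindowPsiBPG` — so along the line [Tᵇ] ∧ [W_Ψᵇ] ∧ [SBᵇ] (XY.2 `pointwise_budget_of_line`, thresholds `min`, radii `max`, NO constant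
matched):
* (Mᵇ) `StrainNonConcentrationBPG aHi Λ θ s` (part UI: `Σ_{win R} σ³ ≤ ε·η·nK(win R)` for a re-registration with tilt–strain data) follows with `Ψ' := Ψ`,
  `Q := refl`, `σ := starStrain S Ψ`: `σ³ ≤ σ²·√(Mη) ≤ ε·η` sitewise once `η ≤ ε²/M³` (XY.1 `cube_le_of_sq_le`) — ★★★ `strainNonConcentrationBPG_of_budget_line`;
  the docket of parts UJ–UN reached (Mᵇ) through [KS] ∧ [CC°ᵇ] ⇒ [C_Tᵇ] (Korn–Sobolev–Poincaré + Caccioppoli ⇒ reverse Hölder) and the Gehring lemma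
  `ZatorskaGoldstein2005_localGehringLemmaCounting` (higher integrability); none of it is needed.
* (R_Wᵇ) `WildFractionBPG aHi Λ θ s` (part UI: wild mass `≤ εw·η·nK(win R)`) follows with `Ψ' := Ψ`: once `η ≤ 1/(800M)`, every `4`-bond distortion of
  `win R` is `≤ σ_x ≤ √(Mη) < 1/20 = tameRadius`, so the wild mass at threshold `tameRadius` VANISHES (XY.1 `wildMass_eq_zero_of_lt`) —
  ★★★ `wildFractionBPG_of_budget_line`; the column of record reached (R_Wᵇ) through (K) `TiltRigidityP` (closed modulo the Literature fact
  `FrieseckeJamesMuller2002_geometricRigidityLp`, part TY) ∧ (Mᵇ) (`wildFractionBPG_of_tilt_strainB`); neither is needed.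
CONSEQUENCES (XY.3): the dressed-core forms ([I_D] ∧ [T_bᵇ] ⇒ [Tᵇ], part UK) and the SB-leaves forms (part XB `subWindowBudgetBPG_of_leaves`); ★★★ the column
`gap_and_pert_1_50_of_certs_16XH20B` = part UI's `_16XH18B_tol` at `ν := 1/2000` with (Υb) discharged (`untwistBookkeepingP_one`) and (R_Wᵇ) cut by the budget
line: its (R_W)-side leaves are [I_D] `DressedCorePG …`, [T_bᵇ] `BareTameWindowBPG …`, [W_Ψᵇ] `CoherentWindowPsiBPG tameRadius 1 2 (1/16) (1/50)`, the SB-glue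
`SubWindowBudgetGlueBPG tameRadius 1 2 3 (1/16) (1/50) (1/25) (1/2000) (1/1000)` (PROVED by g59, part XW), (RC) `EquilChartStrainP (1/25) 3 (1/1000)`, (I4ˢ)
`TailFluxBSP 1 3 (1/16) (1/25)` — hU, hN being the column's own (U♮ᴱ), (N♮) at `ν = 1/2000`.  LEAVING THE COLUMN versus `_16XH19B` + the docket of record:
(K) (and with it the FJM `L^p` fact), the Gehring fact, [KS] `KornSobolevPoincareP 1 (1/16)` (leaf (7)), the CC-glue (leaf (1), proved anyway in part XX),
(Mᵇ), [C_Tᵇ], [Cᵇ].  No statement is re-typed; imports part XX only.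
-/

noncomputable section

open scoped BigOperators
open MeasureTheory Set Metric Filter Topology
open Summit.AtomisticToContinuum.Crystallization.Theorems.ChartedPlanarOrderRigidityDoor (E3 atomsIn VisibleGap PertRegime)
open Summit.AtomisticToContinuum.Crystallization.Theorems.ChartedPlanarOrderDensityDichotomy (μS IsSep nK nK_nonneg)
open Summit.AtomisticToContinuum.Crystallization.Theorems.ChartedPlanarOrderCleanScaleP (IsCleanP IsDoorSetP)
open Summit.AtomisticToContinuum.Crystallization.Theorems.ChartedPlanarOrderMesoCut (LayeredHom EnvClose)
open Summit.AtomisticToContinuum.Crystallization.Theorems.ChartedPlanarOrderDoorLayered (atomsIn_subset sq_le_finsum_mem PeriodicBulkGapDoor)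
open Summit.AtomisticToContinuum.Crystallization.Theorems.ChartedPlanarOrderDoorLayeredOsc (IsTwoShellAffineGood)
open Literature.Analysis.PDE (finavg ZatorskaGoldstein2005_localGehringLemmaCounting)

namespace Summit.AtomisticToContinuum.Crystallization.Theorems.ChartedZeroExcessLayeredLatticeLiouville

/-! ### XY.1  The star strain under a one-ball budget; the cube step; vanishing wild mass -/

/-- the star misfit sum at a site `x ∈ S` is below the bond energy of `p ↦ p − Ψ p` on any ball of radius `> 4` about `x` (its `x`-row). [this file, g60] -/
theorem starSum_le_bondEnergy {δ : ℝ} (hδ : 0 < δ) {S : Set E3} (hsep : IsSep δ S) (Ψ : E3 → E3) {x : E3} (hx : x ∈ S) {ρ : ℝ} (hρ : 4 < ρ) :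
    starSum S Ψ x ≤ bondEnergy (S ∩ ball x ρ) (fun p => p - Ψ p) := by
  have hQ : (S ∩ ball x ρ).Finite := finite_inter_ball_of_isSep hδ hsep x ρ
  have hxQ : x ∈ S ∩ ball x ρ := ⟨hx, mem_ball_self (by linarith)⟩
  have hstar : S ∩ closedBall x 4 = (S ∩ ball x ρ) ∩ closedBall x 4 := by
    ext p
    simp only [mem_inter_iff, mem_closedBall, mem_ball]
    constructor
    · rintro ⟨hp, hpx⟩
      exact ⟨⟨hp, by linarith⟩, hpx⟩
    · rintro ⟨⟨hp, -⟩, hpx⟩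
      exact ⟨hp, hpx⟩
  rw [starSum_eq_row hstar]
  exact le_winsum_of_mem hQ (f := fun y => ∑ᶠ p ∈ (S ∩ ball x ρ) ∩ closedBall y 4, ‖(p - Ψ p) - (y - Ψ y)‖ ^ 2)
    (fun y _ => finsum_nonneg fun _ => finsum_nonneg fun _ => sq_nonneg _) hxQ

/-- ★ POINTWISE: a budget `bondEnergy (S ∩ B(x,ρ)) (p ↦ p − Ψ p) ≤ A_B·η·#(S ∩ B(x,ρ))` on ONE ball of radius `ρ > 4` about the site `x` bounds the star
strain there: `σ_x² ≤ A_B·(2ρ/δ+1)³·η` (packing, part UA). [this file, g60] -/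
theorem starStrain_sq_le_of_budget {δ : ℝ} (hδ : 0 < δ) {S : Set E3} (hsep : IsSep δ S) {Ψ : E3 → E3} {x : E3} (hx : x ∈ S) {ρ AB η : ℝ}
    (hρ : 4 < ρ) (hAB : 0 ≤ AB) (hη : 0 ≤ η) (hbud : bondEnergy (S ∩ ball x ρ) (fun p => p - Ψ p) ≤ AB * η * nK (S ∩ ball x ρ)) :
    starStrain S Ψ x ^ 2 ≤ AB * (2 * ρ / δ + 1) ^ 3 * η := by
  have hpack : nK (S ∩ ball x ρ) ≤ (2 * ρ / δ + 1) ^ 3 := ncard_inter_ball_le_packing hδ hsep x (by linarith)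
  calc starStrain S Ψ x ^ 2 ≤ starSum S Ψ x := starStrain_sq_le_starSum
    _ ≤ bondEnergy (S ∩ ball x ρ) (fun p => p - Ψ p) := starSum_le_bondEnergy hδ hsep Ψ hx hρ
    _ ≤ AB * η * nK (S ∩ ball x ρ) := hbud
    _ ≤ AB * η * (2 * ρ / δ + 1) ^ 3 := mul_le_mul_of_nonneg_left hpack (mul_nonneg hAB hη)
    _ = AB * (2 * ρ / δ + 1) ^ 3 * η := by ring

/-- real arithmetic (the `o(η)` of (Mᵇ)): `0 ≤ σ`, `σ² ≤ M·η`, `1 ≤ M`, `η ≤ ε²/M³` ⇒ `σ³ ≤ ε·η`. [this file, g60] -/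
theorem cube_le_of_sq_le {M ε η σ : ℝ} (hM : 1 ≤ M) (hε : 0 ≤ ε) (hη : 0 ≤ η) (hηε : η ≤ ε ^ 2 / M ^ 3) (hσ : 0 ≤ σ)
    (hsq : σ ^ 2 ≤ M * η) : σ ^ 3 ≤ ε * η := by
  have hM0 : 0 < M := by linarith
  have hMne : M ≠ 0 := hM0.ne'
  have h2 : M * η ≤ (ε / M) ^ 2 := by
    calc M * η ≤ M * (ε ^ 2 / M ^ 3) := mul_le_mul_of_nonneg_left hηε hM0.le
      _ = (ε / M) ^ 2 := by field_simp
  have h3 : σ ≤ ε / M := by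
    calc σ = Real.sqrt (σ ^ 2) := (Real.sqrt_sq hσ).symm
      _ ≤ Real.sqrt (M * η) := Real.sqrt_le_sqrt hsq
      _ ≤ Real.sqrt ((ε / M) ^ 2) := Real.sqrt_le_sqrt h2
      _ = ε / M := Real.sqrt_sq (div_nonneg hε hM0.le)
  calc σ ^ 3 = σ ^ 2 * σ := by ring
    _ ≤ (M * η) * (ε / M) := mul_le_mul hsq h3 hσ (mul_nonneg hM0.le hη)
    _ = ε * η := by field_simp

/-- the wild mass at threshold `ϑ` VANISHES on a chunk all of whose `4`-bond distortions are `< ϑ`. [this file, g60] -/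
theorem wildMass_eq_zero_of_lt {ϑ : ℝ} {Q : Set E3} {Ψ : E3 → E3}
    (h : ∀ x ∈ Q, ∀ p ∈ Q, dist p x ≤ 4 → dist (p - x) (Ψ p - Ψ x) < ϑ) : wildMass ϑ Q Ψ = 0 := by
  unfold wildMass
  rw [finsum_mem_congr rfl fun x hx =>
    finsum_mem_congr rfl fun p hp => if_neg (not_le.2 (h x hx p hp.1 (mem_closedBall.1 hp.2)))]
  simp

/-! ### XY.2  The pointwise budget of the line [Tᵇ] ∧ [W_Ψᵇ] ∧ [SBᵇ]; (Mᵇ) and (R_Wᵇ) -/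

/-- ★★ **MASTER LEMMA — the pointwise budget of the line [Tᵇ] ∧ [W_Ψᵇ] ∧ [SBᵇ].**  For every `(δ, a, Cg)` there is `M ≥ 1` (`:= max (A_B·(2ρ/δ+1)³) 1`,
`ρ := max ρ₀ 5`, from [SBᵇ]) such that for every `K₀` and every cap `η₀ > 0` there are `η₁ ≤ η₀` and `R₁` with: on every admissible window
(`(Cg, η, R)`-registered bond-isomorphic `Ψ`, `K₀`-fat), EVERY site of `win R` has star strain `σ_x² ≤ M·η`.  Tameness on `win 9R` from [Tᵇ], `(ϑ₁, ω₁)`-coherence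
from [W_Ψᵇ] at [SBᵇ]'s tolerances, the budget on `B(x, ρ) ⊆ ball 0 8R` (`ρ ≤ R`) from [SBᵇ]; thresholds `min`, radii `max`. [this file, g60] -/
theorem pointwise_budget_of_line {ϑ aHi Λ θ s : ℝ} (hT : TameWindowBPG ϑ aHi Λ θ s) (hW : CoherentWindowPsiBPG ϑ aHi Λ θ s)
    (hSB : SubWindowBudgetBPG ϑ aHi Λ θ s) {δ : ℝ} (hδ : 0 < δ) {a : ℝ} (ha : 0 < a) {Cg : ℝ} (hCg : 1 ≤ Cg) :
    ∃ M : ℝ, 1 ≤ M ∧ ∀ K₀ : ℝ, 0 < K₀ → ∀ η₀ : ℝ, 0 < η₀ → ∃ η₁ : ℝ, 0 < η₁ ∧ η₁ ≤ η₀ ∧ ∃ R₁ : ℝ, 0 < R₁ ∧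
      ∀ S : Set E3, IsDoorSetPG aHi δ S → (∀ q ∈ S, IsTwoShellAffineGood θ S q) →
        ∀ η : ℝ, 0 < η → η ≤ η₁ → ∀ R : ℝ, R₁ ≤ R →
          ∀ (L : E3 ≃L[ℝ] E3) (w : ℤ → E3), IsEquilChart a s Λ L w →
            ∀ Ψ : E3 → E3, IsGlobalReg Cg η R S (LayeredHom (L : E3 →L[ℝ] E3) w) Ψ → IsBondIso S Ψ →
              K₀ ≤ η * nK (atomsIn (μS S) 0 R) →
                ∀ x ∈ atomsIn (μS S) 0 R, starStrain S Ψ x ^ 2 ≤ M * η := by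
  obtain ⟨AB, hAB, ρ₀, hρ₀, ϑ₁, hϑ₁, ω₁, hω₁, hK⟩ := hSB δ hδ a ha Cg hCg
  set ρ : ℝ := max ρ₀ 5 with hρ
  refine ⟨max (AB * (2 * ρ / δ + 1) ^ 3) 1, le_max_right _ _, fun K₀ hK₀ η₀ hη₀ => ?_⟩
  obtain ⟨η₁, hη₁, R₁, hR₁, h1⟩ := hK K₀ hK₀
  obtain ⟨η₂, hη₂, R₂, hR₂, h2⟩ := hT δ hδ a ha Cg hCg K₀ hK₀
  obtain ⟨η₃, hη₃, R₃, hR₃, h3⟩ := hW ϑ₁ hϑ₁ ω₁ hω₁ δ hδ a ha Cg hCg K₀ hK₀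
  refine ⟨min (min η₁ η₂) (min η₃ η₀), lt_min (lt_min hη₁ hη₂) (lt_min hη₃ hη₀), (min_le_right _ _).trans (min_le_right _ _),
    max (max R₁ R₂) (max R₃ ρ), lt_max_of_lt_left (lt_max_of_lt_left hR₁), ?_⟩
  intro S hS hgood η hη hηle R hR L w hLw Ψ hΨ hBI hfat x hx
  have hη1 : η ≤ η₁ := hηle.trans ((min_le_left _ _).trans (min_le_left _ _))
  have hη2 : η ≤ η₂ := hηle.trans ((min_le_left _ _).trans (min_le_right _ _))
  have hη3 : η ≤ η₃ := hηle.trans ((min_le_right _ _).trans (min_le_left _ _))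
  have hR1 : R₁ ≤ R := ((le_max_left _ _).trans (le_max_left _ _)).trans hR
  have hR2 : R₂ ≤ R := ((le_max_right _ _).trans (le_max_left _ _)).trans hR
  have hR3 : R₃ ≤ R := ((le_max_left _ _).trans (le_max_right _ _)).trans hR
  have hRρ : ρ ≤ R := ((le_max_right _ _).trans (le_max_right _ _)).trans hR
  have htame := h2 S hS hgood η hη hη2 R hR2 L w hLw Ψ hΨ hBI hfat
  have hcoh := h3 S hS hgood η hη hη3 R hR3 L w hLw Ψ hΨ hBI hfat htame
  have hbud := h1 S hS hgood η hη hη1 R hR1 L w hLw Ψ hΨ hBI hfat htame hcoh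
  have hsep : IsSep δ S := hS.1.2.1
  obtain ⟨hxS, hxR⟩ := mem_atomsIn_iff.1 hx
  have hρ4 : 4 < ρ := lt_of_lt_of_le (by norm_num) (le_max_right ρ₀ 5)
  have hball : S ∩ ball x ρ ⊆ ball 0 (8 * R) := by
    intro p hp
    have hpx : ‖p - x‖ < ρ := by rw [← dist_eq_norm]; exact mem_ball.1 hp.2
    rw [mem_ball_zero_iff]
    calc ‖p‖ = ‖p - x + x‖ := by rw [sub_add_cancel]
      _ ≤ ‖p - x‖ + ‖x‖ := norm_add_le _ _
      _ < ρ + R := by linarith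
      _ ≤ 8 * R := by linarith
  exact (starStrain_sq_le_of_budget hδ hsep hxS hρ4 hAB hη.le (hbud x hxS ρ (le_max_left _ _) hball)).trans
    (mul_le_mul_of_nonneg_right (le_max_left _ _) hη.le)

/-- ★★★ **(Mᵇ) FROM THE BUDGET LINE (PROVED): `[Tᵇ] ∧ [W_Ψᵇ] ∧ [SBᵇ] ⇒ StrainNonConcentrationBPG aHi Λ θ s`** — NO Gehring lemma, NO [KS], NO Caccioppoli
inequality: `Ψ' := Ψ`, `Cg' := Cg`, `Q := refl`, `σ := starStrain S Ψ` (tilt–strain data, part XX); sitewise `σ³ ≤ ε·η` by the master lemma at the cap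
`η₀ := ε²/M³` and `cube_le_of_sq_le`; sum over `win R`. [this file, g60] -/
theorem strainNonConcentrationBPG_of_budget_line {ϑ aHi Λ θ s : ℝ} (hT : TameWindowBPG ϑ aHi Λ θ s) (hW : CoherentWindowPsiBPG ϑ aHi Λ θ s)
    (hSB : SubWindowBudgetBPG ϑ aHi Λ θ s) : StrainNonConcentrationBPG aHi Λ θ s := by
  intro δ hδ a ha Cg hCg
  obtain ⟨M, hM1, hP⟩ := pointwise_budget_of_line hT hW hSB hδ ha hCg
  refine ⟨Cg, le_rfl, fun ε hε K₀ hK₀ => ?_⟩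
  have hM0 : 0 < M := by linarith
  obtain ⟨η₁, hη₁, hη₁ε, R₁, hR₁, h1⟩ := hP K₀ hK₀ (ε ^ 2 / M ^ 3) (by positivity)
  refine ⟨η₁, hη₁, R₁, hR₁, ?_⟩
  intro S hS hgood η hη hηle R hR L w hLw Ψ hΨ hBI hfat
  have hsep : IsSep δ S := hS.1.2.1
  have hfin : (atomsIn (μS S) 0 R).Finite := finite_atomsIn hδ hsep R
  have hpt : ∀ x ∈ atomsIn (μS S) 0 R, starStrain S Ψ x ^ 3 ≤ ε * η := fun x hx =>
    cube_le_of_sq_le hM1 hε.le hη.le (hηle.trans hη₁ε) starStrain_nonneg (h1 S hS hgood η hη hηle R hR L w hLw Ψ hΨ hBI hfat x hx)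
  refine ⟨Ψ, hΨ, fun _ => LinearIsometryEquiv.refl ℝ E3, starStrain S Ψ, isTiltStrainData_refl_starStrain hδ hsep hΨ.2.1 R, ?_⟩
  calc ∑ᶠ x ∈ atomsIn (μS S) 0 R, starStrain S Ψ x ^ 3 ≤ ∑ᶠ x ∈ atomsIn (μS S) 0 R, ε * η := winsum_le_winsum_of_le hfin hpt
    _ = ε * η * nK (atomsIn (μS S) 0 R) := by
        unfold nK
        rw [finsum_mem_eq_finite_toFinset_sum _ hfin, Finset.sum_const, nsmul_eq_mul, Set.ncard_eq_toFinset_card _ hfin]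
        ring

/-- ★★★ **(R_Wᵇ) FROM THE BUDGET LINE (PROVED): `[Tᵇ] ∧ [W_Ψᵇ] ∧ [SBᵇ] ⇒ WildFractionBPG aHi Λ θ s`** — NO (K) `TiltRigidityP`, NO (Mᵇ): `Ψ' := Ψ`,
`Cg' := Cg`; at the cap `η₀ := 1/(800M)` every `4`-bond distortion of `win R` is `≤ σ_x ≤ √(Mη) < 1/20 = tameRadius` (part XX `dist_bond_le_starStrain`), so
`wildMass tameRadius (win R) Ψ = 0`. [this file, g60] -/
theorem wildFractionBPG_of_budget_line {ϑ aHi Λ θ s : ℝ} (hT : TameWindowBPG ϑ aHi Λ θ s) (hW : CoherentWindowPsiBPG ϑ aHi Λ θ s)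
    (hSB : SubWindowBudgetBPG ϑ aHi Λ θ s) : WildFractionBPG aHi Λ θ s := by
  intro δ hδ a ha Cg hCg
  obtain ⟨M, hM1, hP⟩ := pointwise_budget_of_line hT hW hSB hδ ha hCg
  refine ⟨Cg, le_rfl, fun εw hεw K₀ hK₀ => ?_⟩
  have hM0 : 0 < M := by linarith
  have hMne : M ≠ 0 := hM0.ne'
  obtain ⟨η₁, hη₁, hη₁0, R₁, hR₁, h1⟩ := hP K₀ hK₀ (1 / (800 * M)) (by positivity)
  refine ⟨η₁, hη₁, R₁, hR₁, ?_⟩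
  intro S hS hgood η hη hηle R hR L w hLw Ψ hΨ hBI hfat
  have hsep : IsSep δ S := hS.1.2.1
  have hMη : M * η < tameRadius ^ 2 := by
    calc M * η ≤ M * (1 / (800 * M)) := mul_le_mul_of_nonneg_left (hηle.trans hη₁0) hM0.le
      _ = 1 / 800 := by field_simp
      _ < tameRadius ^ 2 := by norm_num [tameRadius]
  have hlt : ∀ x ∈ atomsIn (μS S) 0 R, ∀ p ∈ atomsIn (μS S) 0 R, dist p x ≤ 4 → dist (p - x) (Ψ p - Ψ x) < tameRadius := by
    intro x hx p hp hpx
    have hsq := h1 S hS hgood η hη hηle R hR L w hLw Ψ hΨ hBI hfat x hx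
    have hd := dist_bond_le_starStrain hδ hsep hΨ.2.1 (mem_atomsIn_iff.1 hx).1 (mem_atomsIn_iff.1 hp).1 hpx
    exact lt_of_pow_lt_pow_left₀ 2 tameRadius_pos.le (((pow_le_pow_left₀ dist_nonneg hd 2).trans hsq).trans_lt hMη)
  refine ⟨Ψ, hΨ, ?_⟩
  rw [wildMass_eq_zero_of_lt hlt]
  exact mul_nonneg (mul_nonneg hεw.le hη.le) (nK_nonneg _)

/-! ### XY.3  The dressed-core and SB-leaves forms; the column `_16XH20B` -/

/-- ★★ (Mᵇ) from [I_D] ∧ [T_bᵇ] ∧ [W_Ψᵇ] ∧ [SBᵇ] (part UK `tameWindowBPG_of_dressedCore_of_bare`). [this file, g60] -/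
theorem strainNonConcentrationBPG_of_dressedCore_budget {ϑ ϑe ωe : ℝ} {p : ℕ} {r₀ ℓ : ℝ} {M : ℕ} {aHi Λ θ s : ℝ}
    (hI : DressedCorePG ϑ ϑe ωe p r₀ ℓ M aHi Λ θ s) (hTb : BareTameWindowBPG ϑ ϑe ωe p r₀ ℓ M aHi Λ θ s) (hW : CoherentWindowPsiBPG ϑ aHi Λ θ s)
    (hSB : SubWindowBudgetBPG ϑ aHi Λ θ s) : StrainNonConcentrationBPG aHi Λ θ s :=
  strainNonConcentrationBPG_of_budget_line (tameWindowBPG_of_dressedCore_of_bare hI hTb) hW hSB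

/-- ★★ (R_Wᵇ) from [I_D] ∧ [T_bᵇ] ∧ [W_Ψᵇ] ∧ [SBᵇ]. [this file, g60] -/
theorem wildFractionBPG_of_dressedCore_budget {ϑ ϑe ωe : ℝ} {p : ℕ} {r₀ ℓ : ℝ} {M : ℕ} {aHi Λ θ s : ℝ}
    (hI : DressedCorePG ϑ ϑe ωe p r₀ ℓ M aHi Λ θ s) (hTb : BareTameWindowBPG ϑ ϑe ωe p r₀ ℓ M aHi Λ θ s) (hW : CoherentWindowPsiBPG ϑ aHi Λ θ s)
    (hSB : SubWindowBudgetBPG ϑ aHi Λ θ s) : WildFractionBPG aHi Λ θ s :=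
  wildFractionBPG_of_budget_line (tameWindowBPG_of_dressedCore_of_bare hI hTb) hW hSB

/-- ★★ (R_Wᵇ) from [I_D] ∧ [T_bᵇ] ∧ [W_Ψᵇ] ∧ the SB-glue ∧ (RC) ∧ (I4ˢ) ∧ hU ∧ hN (part XB `subWindowBudgetBPG_of_leaves`). [this file, g60] -/
theorem wildFractionBPG_of_dressedCore_sbLeaves {ϑ ϑe ωe : ℝ} {p : ℕ} {r₀ ℓ : ℝ} {M : ℕ} {aHi Λ Λ' θ s s' ν ν' : ℝ}
    (hI : DressedCorePG ϑ ϑe ωe p r₀ ℓ M aHi Λ θ s) (hTb : BareTameWindowBPG ϑ ϑe ωe p r₀ ℓ M aHi Λ θ s) (hW : CoherentWindowPsiBPG ϑ aHi Λ θ s)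
    (hglueS : SubWindowBudgetGlueBPG ϑ aHi Λ Λ' θ s s' ν ν') (hRC : EquilChartStrainP s' Λ' ν') (h4 : TailFluxBSP aHi Λ' θ s')
    (hU : UniformTameStabilityE s Λ ν) (hN : EnergyNearChartPX aHi Λ θ s ν) : WildFractionBPG aHi Λ θ s :=
  wildFractionBPG_of_dressedCore_budget hI hTb hW (subWindowBudgetBPG_of_leaves hglueS hRC h4 hU hN)

/-- ★★★ **COLUMN `_16XH20B`** — part UI's `_16XH18B_tol` at `ν := 1/2000` with (Υb) discharged (`untwistBookkeepingP_one`, as in `_16XH19B`) and (R_Wᵇ) CUT BY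
THE BUDGET LINE (`wildFractionBPG_of_dressedCore_sbLeaves`): the twenty generic leaves of `_16XH19B` (hU, hN shared with the budget line), then [I_D], [T_bᵇ],
[W_Ψᵇ], the SB-glue (PROVED, g59 part XW), (RC), (I4ˢ), and the crystal import `PeriodicBulkGapDoor 2`.  Versus `_16XH19B` + the docket of parts UJ–XB: (K),
(Mᵇ), the Gehring fact, [KS], the CC-glue, [C_Tᵇ], [Cᵇ] have LEFT the column. [this file, g60] -/
theorem gap_and_pert_1_50_of_certs_16XH20B (hL : LatticeLiouvilleCert) (hL' : LayeredLiouvilleCert)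
    (hR : OscRigidityL2BDPG 1 2 (1 / 16) (1 / 16)) (hX : ExcessFlatnessControlP 1 2 (1 / 16) (1 / 16))
    (hE : ExcessChartLocalisationP 1 2 (1 / 16) (1 / 100)) (hP : RegistrationP 1 2 (1 / 16) (1 / 100))
    (hT : TailDominationCert) (hU : UniformTameStabilityE (1 / 50) 2 (1 / 2000))
    (h1 : WordTransplantP 1 2 (1 / 16) (1 / 100)) (hGT : GradReframingThickP 1 2 (1 / 16) (1 / 100) (1 / 50))
    (hΛ0 : LaunderingAprioriPX 1 2 (1 / 16) (1 / 100) (1 / 50)) (hΛs : LaunderingStepPX 1 2 (1 / 16) (1 / 100) (1 / 50))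
    (hUc : UntwistCollarP 1 2 (1 / 16) (1 / 50))
    (hl : BondIsoLevelsP 1 2 (1 / 16) (1 / 50)) (hN : EnergyNearChartPX 1 2 (1 / 16) (1 / 50) (1 / 2000))
    (hF : TailForceSlavingP 1 2 (1 / 16) (1 / 50))
    (hE' : LipDualLinearisationP 1 2 (1 / 16) (1 / 50)) (hA : L2HarmonicApproxPE 1 2 (1 / 16) (1 / 50) (1 / 2000))
    (hD : PositionDecayPLE 1 2 (1 / 16) (1 / 50) (1 / 2000)) (hC : PositionCaccioppoliPGE 1 2 (1 / 16) (1 / 50) (1 / 2000))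
    (hI : DressedCorePG tameRadius dressLevel dressLevel dressExponent 8 collarRadius clusterSize 1 2 (1 / 16) (1 / 50))
    (hTb : BareTameWindowBPG tameRadius dressLevel dressLevel dressExponent 8 collarRadius clusterSize 1 2 (1 / 16) (1 / 50))
    (hWΨ : CoherentWindowPsiBPG tameRadius 1 2 (1 / 16) (1 / 50))
    (hglueS : SubWindowBudgetGlueBPG tameRadius 1 2 3 (1 / 16) (1 / 50) (1 / 25) (1 / 2000) (1 / 1000))
    (hRC : EquilChartStrainP (1 / 25) 3 (1 / 1000)) (h4 : TailFluxBSP 1 3 (1 / 16) (1 / 25))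
    (hG : PeriodicBulkGapDoor 2) : VisibleGap (1 / 50) ∧ PertRegime (1 / 50) :=
  gap_and_pert_1_50_of_certs_16XH18B_tol hL hL' hR hX hE hP hT hU h1 hGT hΛ0 hΛs hUc (untwistBookkeepingP_one 2 (1 / 50)) hl hN hF hE' hA hD hC
    (wildFractionBPG_of_dressedCore_sbLeaves hI hTb hWΨ hglueS hRC h4 hU hN) hG

/-- Record example: (Mᵇ) `StrainNonConcentrationBPG 1 2 (1/16) (1/50)` — the target of the docket of record `strainNonConcentrationBPG_1_50_of_docketPsi` (part UN)
— from [I_D], [T_bᵇ], [W_Ψᵇ], the SB-glue, (RC), (I4ˢ), hU, hN ONLY: the Gehring fact, [KS] and the CC-glue of that docket are not consumed. [this file, g60] -/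
example (hI : DressedCorePG tameRadius dressLevel dressLevel dressExponent 8 collarRadius clusterSize 1 2 (1 / 16) (1 / 50))
    (hTb : BareTameWindowBPG tameRadius dressLevel dressLevel dressExponent 8 collarRadius clusterSize 1 2 (1 / 16) (1 / 50))
    (hW : CoherentWindowPsiBPG tameRadius 1 2 (1 / 16) (1 / 50))
    (hglueS : SubWindowBudgetGlueBPG tameRadius 1 2 3 (1 / 16) (1 / 50) (1 / 25) (1 / 2000) (1 / 1000))
    (hRC : EquilChartStrainP (1 / 25) 3 (1 / 1000)) (h4 : TailFluxBSP 1 3 (1 / 16) (1 / 25))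
    (hU : UniformTameStabilityE (1 / 50) 2 (1 / 2000)) (hN : EnergyNearChartPX 1 2 (1 / 16) (1 / 50) (1 / 2000)) :
    StrainNonConcentrationBPG 1 2 (1 / 16) (1 / 50) :=
  strainNonConcentrationBPG_of_dressedCore_budget hI hTb hW (subWindowBudgetBPG_of_leaves hglueS hRC h4 hU hN)

end Summit.AtomisticToContinuum.Crystallization.Theorems.ChartedZeroExcessLayeredLatticeLiouville

end
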